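import Summits.NavierStokesRegularity.FluidComputer.ClayBlowupLocalZoom
import Summits.NavierStokesRegularity.FluidComputer.ClayBlowupForcedAlignment
import Mathlib.Analysis.Calculus.BumpFunction.InnerProduct
import HarnessLib

/-!
# LOCAL GIGA–MIURA WITH THE CLAY FORCE: at EVERY singular point of a Clay blow-up, a LOCAL
# Type I bound and LOCAL continuous alignment of the vorticity directions are incompatible

Cell `ns-blowup`, seat `ns-blowup-ecbridge-2` (g11; the E–C endpoint theory seat). LABEL: E–C typing
(KERNEL — no named fact, no new definition). WHAT THIS IS NOT: not Navier–Stokes evidence — a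
necessary condition on the (uninhabited, as far as anyone knows) TYPE `ClayBlowup 1` with its Clay
force; no inhabitant is claimed. Companion memo:
`run/shared/lean/pub/ns-blowup/ecbridge2/ECBRIDGE-2-MEMO-10.md`.

## Content

g10's `ClayBlowup.not_scaledAlignment_of_typeI_one` (Giga–Miura 2011, Thm 1.1 under Rem. 1.4, WITH
the Clay force) needs the Type I bound `‖u(t, x)‖ ≤ C/√(T − t)` at ALL points and the scaled
continuous alignment (CA′) for ALL pairs of points, because its zoom (`exists_zoom_limit`) is centred
at GLOBAL near-maxima. With the LOCAL zoom of `ClayBlowupLocalZoom.lean` (`exists_local_zoom_limit`: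
a nontrivial bounded ancient mild limit at a PRESCRIBED singular point) both hypotheses localise to an
arbitrarily small ball around any one singular point `x₁`:

* `ClayBlowup.not_localAlignment_of_localTypeI_one` — for `Y : ClayBlowup 1`, a point `x₁` which is
  NOT backward bounded, a radius `r₀ > 0`, a Type I bound `‖u(t, x)‖ ≤ C/√(T − t)` for `t` near `T`
  and `x ∈ B(x₁, r₀)` ONLY, and (CA′) for pairs of points of `B(x₁, r₀)` ONLY: `False`.

Proof: the local zoom slices `w_j(s) = c_j u(t_j + c_j² s, x_j + c_j ·)` converge pointwise to
`W(s)`; the local Type I bound makes them bounded by `|C|/√(−s)` on the balls `B(0, r₀/(2c_j))`, which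
exhaust space, and gives the Type I decay `√(−s) ‖W(s, z)‖ ≤ C` of the limit; multiplying `w_j(s)` by
a smooth bump equal to `1` on `B(0, r₀/(4c_j))` and supported in `B(0, r₀/(2c_j))` produces globally
bounded `C¹` fields with the same curl on every fixed ball, eventually, to which the tree's
`exists_unidirectional_curl_of_tendsto_of_aligned` applies with the LOCAL (CA′); Giga–Miura's
Propositions 2.2 (`gigaMiura2011_unidirectional_vorticity_eq_zero_holds`) and 2.1
(`gigaMiura2011_curl_not_identically_zero_of_typeI`) then collide on the limit exactly as in g10.

References: Y. Giga, H. Miura, Comm. Math. Phys. 303 (2011), Thm 1.1, Rem. 1.4, Props 2.1–2.2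
[cite: GigaMiura2011, Thm 1.1 and §2.1]; Koch–Nadirashvili–Seregin–Šverák, Acta Math. 203 (2009),
Prop 6.1, Thm 5.1 [cite: KochNadirashviliSereginSverak2009, Prop 6.1]; C. L. Fefferman, (C)
[cite: FeffermanClay2006, (C)].
-/

noncomputable section

namespace Summit.NavierStokesRegularity.FluidComputer

open Set MeasureTheory Filter Topology Function Metric
open scoped ENNReal NNReal InnerProductSpace RealInnerProductSpace
open Literature.Analysis Literature.Analysis.FluidPDE
open Summit.NavierStokesRegularity.NavierStokesRegularity

namespace ClayBlowup

set_option maxHeartbeats 800000 in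
-- one long bookkeeping proof: three passages to the limit and the Giga–Miura collision
/-- **LOCAL GIGA–MIURA WITH THE CLAY FORCE (`ν = 1`; no named fact)**: for a Clay blow-up at
viscosity `1` with ANY Clay force and ANY point `x₁` which is not backward bounded at the blow-up
time, a Type I bound `‖u(t, x)‖ ≤ C/√(T − t)` for `t` near `T` and `x ∈ B(x₁, r₀)` and the scaled
continuous alignment (CA′) of the vorticity directions on `{|ω| > d} ∩ B(x₁, r₀)` cannot both hold,
however small `r₀ > 0` is. The local zoom with force (`exists_local_zoom_limit`); Type I and (CA′) pass
to the limit (the latter through smooth bumps and `exists_unidirectional_curl_of_tendsto_of_aligned`);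
the tree's cores of Giga–Miura's Propositions 2.2 and 2.1 on the limit. [cite: GigaMiura2011, Thm 1.1 and §2.1]
[cite: KochNadirashviliSereginSverak2009, Prop 6.1] -/
theorem not_localAlignment_of_localTypeI_one (Y : ClayBlowup 1) {x₁ : EuclideanSpace ℝ (Fin 3)}
    (hx₁ : ¬ IsBackwardBoundedAt Y.u Y.T x₁) {r₀ : ℝ} (hr₀ : 0 < r₀)
    (hI : ∃ C : ℝ, ∀ᶠ t in 𝓝[<] Y.T, ∀ x ∈ ball x₁ r₀, ‖Y.u t x‖ ≤ C / Real.sqrt (Y.T - t))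
    (hCA : ∃ d : ℝ, 0 < d ∧ ∃ η θ : ℝ → ℝ, MonotoneOn η (Ici 0) ∧ ContinuousOn η (Ici 0) ∧ η 0 = 0 ∧
      (∀ t, 0 ≤ θ t) ∧ Tendsto θ (𝓝[<] Y.T) (𝓝 0) ∧
      ∀ t ∈ Ioo 0 Y.T, ∀ x ∈ ball x₁ r₀, ∀ x' ∈ ball x₁ r₀,
        d < ‖curl (Y.u t) x‖ → d < ‖curl (Y.u t) x'‖ →
          ‖vorticityDirection (curl (Y.u t)) x - vorticityDirection (curl (Y.u t)) x'‖ ≤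
            η (θ t * ‖x - x'‖ / Real.sqrt (1 * (Y.T - t)))) : False := by
  have hT := Y.T_pos
  obtain ⟨d₀, hd₀, η, θ, hηm, hηc, hη0, hθ0, hθ, hal⟩ := hCA
  obtain ⟨C, hC⟩ := hI
  -- ### the local zoom at `x₁`, centres in `B(x₁, min 1 (r₀/2))`, times after `T/2`
  have hr' : 0 < min 1 (r₀ / 2) := lt_min one_pos (by positivity)
  have ht_b : Y.T / 2 ∈ Ico 0 Y.T := ⟨by positivity, by linarith⟩
  obtain ⟨t, x, φ, W, hφ, ht, hx, hk1, hWc0, hWdiv0, hWmild0, hW4, ⟨σ₁, hσ₁, hhalf⟩, hconv⟩ :=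
    Y.exists_local_zoom_limit hx₁ hr' (min_le_left _ _) ht_b
  obtain ⟨c, hc⟩ : ∃ c : ℕ → ℝ, ∀ k, c k = ‖Y.u (t k) (x k)‖⁻¹ := ⟨_, fun k => rfl⟩
  simp_rw [← hc] at hconv
  have hM0 : ∀ k, 0 < ‖Y.u (t k) (x k)‖ := fun k => lt_of_lt_of_le (by positivity) (hk1 k)
  have hc0 : ∀ k, 0 < c k := fun k => by rw [hc k]; exact inv_pos.2 (hM0 k)
  have hcM : ∀ k, c k * ‖Y.u (t k) (x k)‖ = 1 := fun k => by
    rw [hc k]; exact inv_mul_cancel₀ (hM0 k).ne'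
  have htI : ∀ k, t k ∈ Ioo 0 Y.T := fun k => ⟨lt_of_lt_of_le (by positivity) (ht k).1, (ht k).2⟩
  have hxr : ∀ k, dist (x k) x₁ < r₀ / 2 := fun k =>
    lt_of_lt_of_le (mem_ball.1 (hx k)) (min_le_right _ _)
  -- the zoom slices and their pointwise convergence at `s < 0`
  set w : ℕ → ℝ → EuclideanSpace ℝ (Fin 3) → EuclideanSpace ℝ (Fin 3) :=
    fun j => c (φ j) • stPull (c (φ j) ^ 2) (c (φ j)) (t (φ j)) (x (φ j)) Y.u with hw
  have hpt : ∀ s < 0, ∀ z, Tendsto (fun j => w j s z) atTop (𝓝 (W s z)) := fun s hs z =>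
    hconv s hs z
  -- ### the slice times `t'_j(s) = t_{φ j} + c_{φ j}² s → T⁻`
  have htT : Tendsto t atTop (𝓝[<] Y.T) := Y.tendsto_of_norm_ge one_pos htI hk1
  have hcto : Tendsto c atTop (𝓝 0) := by
    have hMto : Tendsto (fun k => ‖Y.u (t k) (x k)‖) atTop atTop := by
      refine tendsto_atTop_atTop.2 fun B => ⟨⌈B⌉₊, fun k hk => ?_⟩
      have h1 : (⌈B⌉₊ : ℝ) ≤ k := by exact_mod_cast hk
      linarith [Nat.le_ceil B, hk1 k]
    exact (tendsto_inv_atTop_zero.comp hMto).congr fun k => by simp [Function.comp, hc k]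
  have htime : ∀ s ≤ 0, Tendsto (fun j => t (φ j) + c (φ j) ^ 2 * s) atTop (𝓝[<] Y.T) := by
    intro s hs
    have h1 : Tendsto (fun j => t (φ j)) atTop (𝓝 Y.T) :=
      (tendsto_nhdsWithin_iff.1 htT).1.comp hφ.tendsto_atTop
    have h2 : Tendsto (fun j => c (φ j) ^ 2 * s) atTop (𝓝 0) := by
      simpa using ((hcto.comp hφ.tendsto_atTop).pow 2).mul_const s
    refine tendsto_nhdsWithin_iff.2 ⟨by simpa using h1.add h2, Eventually.of_forall fun j => ?_⟩
    have : c (φ j) ^ 2 * s ≤ 0 := mul_nonpos_of_nonneg_of_nonpos (sq_nonneg _) hs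
    exact lt_of_le_of_lt (by linarith) (ht (φ j)).2
  -- eventually the slice time lies in `(0, t_{φ j}]`
  have hmem : ∀ s ≤ 0, ∀ᶠ j in atTop, t (φ j) + c (φ j) ^ 2 * s ∈ Ioc 0 (t (φ j)) := by
    intro s hs
    filter_upwards [(htime s hs).eventually (Ioo_mem_nhdsLT hT)] with j hj
    have : c (φ j) ^ 2 * s ≤ 0 := mul_nonpos_of_nonneg_of_nonpos (sq_nonneg _) hs
    exact ⟨hj.1, by linarith⟩
  -- `T − t' ≥ c² (−s)`, in square-root form: `c √(−s) ≤ √(T − t')`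
  have hsqrt : ∀ s ≤ 0, ∀ j, c (φ j) * Real.sqrt (-s) ≤
      Real.sqrt (Y.T - (t (φ j) + c (φ j) ^ 2 * s)) := by
    intro s hs j
    have e1 : c (φ j) * Real.sqrt (-s) = Real.sqrt (c (φ j) ^ 2 * -s) := by
      rw [Real.sqrt_mul (sq_nonneg _), Real.sqrt_sq (hc0 _).le]
    rw [e1]
    refine Real.sqrt_le_sqrt ?_
    have e2 : c (φ j) ^ 2 * -s = -(c (φ j) ^ 2 * s) := by ring
    rw [e2]
    linarith [(ht (φ j)).2]
  -- ### spatial localisation: eventually `c_{φ j} A < r₀/4`; physical points stay in `B(x₁, r₀)`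
  have hsmall : ∀ A : ℝ, ∀ᶠ j in atTop, c (φ j) * A < r₀ / 4 := fun A => by
    have h : Tendsto (fun j => c (φ j) * A) atTop (𝓝 (0 * A)) :=
      (hcto.comp hφ.tendsto_atTop).mul_const A
    rw [zero_mul] at h
    exact h.eventually (gt_mem_nhds (by positivity))
  have hball : ∀ j (z : EuclideanSpace ℝ (Fin 3)), c (φ j) * ‖z‖ < r₀ / 2 →
      x (φ j) + c (φ j) • z ∈ ball x₁ r₀ := by
    intro j z hz
    rw [mem_ball, dist_eq_norm]
    have e : x (φ j) + c (φ j) • z - x₁ = (x (φ j) - x₁) + c (φ j) • z := by abel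
    rw [e]
    have h1 : ‖x (φ j) - x₁‖ < r₀ / 2 := by rw [← dist_eq_norm]; exact hxr _
    have h2 : ‖c (φ j) • z‖ < r₀ / 2 := by
      rwa [norm_smul, Real.norm_of_nonneg (hc0 _).le]
    linarith [norm_add_le (x (φ j) - x₁) (c (φ j) • z)]
  -- ### (1) Type I passes to the limit
  have hIW : ∀ s < 0, ∀ z, Real.sqrt (-s) * ‖W s z‖ ≤ C := by
    intro s hs z
    have hs0 : 0 < Real.sqrt (-s) := Real.sqrt_pos.2 (by linarith)
    refine le_of_tendsto (((hpt s hs z).norm).const_mul _) ?_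
    filter_upwards [(htime s hs.le).eventually hC, hmem s hs.le, hsmall ‖z‖] with j hj hjm hjz
    simp only [hw, smul_stPull_apply, norm_smul, Real.norm_of_nonneg (hc0 (φ j)).le]
    have h1 := hj (x (φ j) + c (φ j) • z) (hball j z (by linarith))
    have h2 := hsqrt s hs.le j
    have hTt : 0 < Real.sqrt (Y.T - (t (φ j) + c (φ j) ^ 2 * s)) :=
      lt_of_lt_of_le (mul_pos (hc0 _) hs0) h2
    have hC0 : 0 ≤ C := by
      have h0 := (norm_nonneg _).trans h1
      exact (div_nonneg_iff.1 h0).elim (fun h => h.1) fun h => absurd h.2 (not_le.2 hTt)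
    have hcφ : 0 ≤ c (φ j) := (hc0 _).le
    calc Real.sqrt (-s) * (c (φ j) * ‖Y.u (t (φ j) + c (φ j) ^ 2 * s) (x (φ j) + c (φ j) • z)‖)
        ≤ Real.sqrt (-s) * (c (φ j) * (C / Real.sqrt (Y.T - (t (φ j) + c (φ j) ^ 2 * s)))) := by
          gcongr
      _ = C * (c (φ j) * Real.sqrt (-s) / Real.sqrt (Y.T - (t (φ j) + c (φ j) ^ 2 * s))) := by
          ring
      _ ≤ C * 1 := by
          gcongr
          rw [div_le_one hTt]; exact h2
      _ = C := mul_one C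
  -- ### (2) the limit is non-trivial before the vertex
  have hnt : ∃ s < 0, ∃ z, W s z ≠ 0 := by
    refine ⟨-(σ₁ / 2), by linarith, 0, fun h => ?_⟩
    have h1 := hhalf (-(σ₁ / 2)) ⟨by linarith, by linarith⟩
    rw [h, norm_zero] at h1
    linarith
  -- ### the limit on `(−∞, 0)`: smooth with bounded derivatives
  obtain ⟨hsm, hder⟩ := smooth_and_bounds_of_bounded_ancient_oseenMild hWc0 hWdiv0 hWmild0 hW4
  have hslice : ∀ s < 0, ContDiff ℝ (⊤ : ℕ∞) (W s) := fun s hs =>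
    hsm.comp_contDiff (contDiff_prodMk_right s) fun y => mk_mem_prod (mem_Iio.2 hs) (mem_univ y)
  -- ### (3) every slice of the limit has unidirectional vorticity
  have hdir : ∀ s < 0, ∃ ζ : EuclideanSpace ℝ (Fin 3), ∀ z, curl (W s) z = ‖curl (W s) z‖ • ζ := by
    intro s hs
    have hs0 : 0 < Real.sqrt (-s) := Real.sqrt_pos.2 (by linarith)
    -- smooth bumps `β_j`: `= 1` on `B̄(0, ρ_j)`, supported in `B(0, 2ρ_j)`, `ρ_j = r₀/(4 c_{φ j})`
    obtain ⟨ρ, hρ⟩ : ∃ ρ : ℕ → ℝ, ∀ j, ρ j = r₀ / (4 * c (φ j)) := ⟨_, fun j => rfl⟩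
    have hρ0 : ∀ j, 0 < ρ j := fun j => by rw [hρ]; exact div_pos hr₀ (by linarith [hc0 (φ j)])
    have hρbig : ∀ j (A : ℝ), 0 ≤ A → c (φ j) * (4 * A) < r₀ / 4 → A < ρ j := by
      intro j A hA h
      rw [hρ, lt_div_iff₀ (by linarith [hc0 (φ j)])]
      nlinarith [hc0 (φ j)]
    have hρin : ∀ j (z : EuclideanSpace ℝ (Fin 3)), ‖z‖ < 2 * ρ j → c (φ j) * ‖z‖ < r₀ / 2 := by
      intro j z hz
      have hc' := hc0 (φ j)
      have e : c (φ j) * (2 * ρ j) = r₀ / 2 := by rw [hρ]; field_simp; ring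
      calc c (φ j) * ‖z‖ < c (φ j) * (2 * ρ j) := mul_lt_mul_of_pos_left hz hc'
        _ = r₀ / 2 := e
    let β : ∀ j : ℕ, ContDiffBump (0 : EuclideanSpace ℝ (Fin 3)) := fun j =>
      ⟨ρ j, 2 * ρ j, hρ0 j, by linarith [hρ0 j]⟩
    have hβ1 : ∀ j (z : EuclideanSpace ℝ (Fin 3)), ‖z‖ < ρ j → (β j : _ → ℝ) =ᶠ[𝓝 z] 1 :=
      fun j z hz => (β j).eventuallyEq_one_of_mem_ball (mem_ball_zero_iff.2 hz)
    have hβ0 : ∀ j (z : EuclideanSpace ℝ (Fin 3)), 2 * ρ j ≤ ‖z‖ → (β j) z = 0 :=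
      fun j z hz => (β j).zero_of_le_dist (by rwa [dist_zero_right])
    -- the truncated slices
    obtain ⟨w', hw'⟩ : ∃ w' : ℕ → EuclideanSpace ℝ (Fin 3) → EuclideanSpace ℝ (Fin 3),
        ∀ j z, w' j z = (β j) z • w j s z := ⟨_, fun j z => rfl⟩
    have hw'eq : ∀ j (z : EuclideanSpace ℝ (Fin 3)), ‖z‖ < ρ j → w' j =ᶠ[𝓝 z] w j s := by
      intro j z hz
      filter_upwards [hβ1 j z hz] with z' hz'
      rw [hw', hz', Pi.one_apply, one_smul]
    have hcurl' : ∀ j (z : EuclideanSpace ℝ (Fin 3)), ‖z‖ < ρ j →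
        curl (w' j) z = curl (w j s) z := by
      intro j z hz
      rw [curl_eq_curlCLM, curl_eq_curlCLM, (hw'eq j z hz).fderiv_eq]
    have hdir' : ∀ j (z : EuclideanSpace ℝ (Fin 3)), ‖z‖ < ρ j →
        vorticityDirection (curl (w' j)) z = vorticityDirection (curl (w j s)) z := by
      intro j z hz
      rw [vorticityDirection_apply, vorticityDirection_apply, hcurl' j z hz]
    refine exists_unidirectional_curl_of_tendsto_of_aligned (K := |C| / Real.sqrt (-s)) (w := w')
      ?_ ((hslice s hs).of_le (by norm_cast)) (by positivity) ?_ ?_ fun R => ?_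
    · -- the truncated zoom slices are `C¹`, eventually
      filter_upwards [hmem s hs.le] with j hj
      have htI' : t (φ j) + c (φ j) ^ 2 * s ∈ Ico 0 Y.T := ⟨hj.1.le, hj.2.trans_lt (ht (φ j)).2⟩
      have hcd := Y.classical.contDiff_velocity htI'
      have e : w' j = fun z => (β j) z •
          (c (φ j) • Y.u (t (φ j) + c (φ j) ^ 2 * s) (x (φ j) + c (φ j) • z)) :=
        funext fun z => by rw [hw']; rfl
      rw [e]
      have haff : ContDiff ℝ 1 (fun z : EuclideanSpace ℝ (Fin 3) => x (φ j) + c (φ j) • z) :=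
        contDiff_const.add (contDiff_id.const_smul (c (φ j)))
      have h1 : ContDiff ℝ 1 (Y.u (t (φ j) + c (φ j) ^ 2 * s)) := hcd.of_le (by norm_cast)
      exact ((β j).contDiff (n := 1)).smul ((h1.comp haff).const_smul (c (φ j)))
    · -- bounded by `|C|/√(−s)`, eventually (local Type I inside the bump, zero outside)
      filter_upwards [(htime s hs.le).eventually hC, hmem s hs.le] with j hj hjm z
      by_cases hz : ‖z‖ < 2 * ρ j
      · have hβle : ‖(β j) z‖ ≤ 1 := by
          rw [Real.norm_of_nonneg (β j).nonneg]; exact (β j).le_one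
        have h1 := hj (x (φ j) + c (φ j) • z) (hball j z (hρin j z hz))
        have h2 := hsqrt s hs.le j
        have hTt : 0 < Real.sqrt (Y.T - (t (φ j) + c (φ j) ^ 2 * s)) :=
          lt_of_lt_of_le (mul_pos (hc0 _) hs0) h2
        have hcφ : 0 ≤ c (φ j) := (hc0 _).le
        rw [hw', norm_smul, le_div_iff₀ hs0]
        simp only [hw, smul_stPull_apply, norm_smul, Real.norm_of_nonneg hcφ]
        calc ‖(β j) z‖ * (c (φ j) * ‖Y.u (t (φ j) + c (φ j) ^ 2 * s) (x (φ j) + c (φ j) • z)‖) *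
              Real.sqrt (-s)
            ≤ 1 * (c (φ j) * (|C| / Real.sqrt (Y.T - (t (φ j) + c (φ j) ^ 2 * s)))) *
              Real.sqrt (-s) := by
              gcongr
              exact h1.trans (by gcongr; exact le_abs_self C)
          _ = |C| * (c (φ j) * Real.sqrt (-s) / Real.sqrt (Y.T - (t (φ j) + c (φ j) ^ 2 * s))) := by
              ring
          _ ≤ |C| * 1 := by
              gcongr
              rw [div_le_one hTt]; exact h2
          _ = |C| := mul_one _
      · rw [hw', hβ0 j z (not_lt.1 hz), zero_smul, norm_zero]
        positivity
    · -- pointwise convergence: the bump is eventually `1` at `z`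
      intro z
      refine (hpt s hs z).congr' ?_
      filter_upwards [hsmall (4 * ‖z‖)] with j hj
      have hzρ : ‖z‖ < ρ j := hρbig j ‖z‖ (norm_nonneg _) hj
      rw [hw', (β j).one_of_mem_closedBall (mem_closedBall_zero_iff.2 hzρ.le), one_smul]
    · -- (CA′) along the truncated zoom slices on the ball `B(0, R)`
      set arg : ℕ → ℝ := fun j => θ (t (φ j) + c (φ j) ^ 2 * s) * (2 * |R|) / Real.sqrt (-s)
        with harg
      have harg0 : ∀ j, 0 ≤ arg j := fun j =>
        div_nonneg (mul_nonneg (hθ0 _) (by positivity)) (Real.sqrt_nonneg _)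
      have harglim : Tendsto arg atTop (𝓝 0) := by
        have h1 : Tendsto (fun j => θ (t (φ j) + c (φ j) ^ 2 * s)) atTop (𝓝 0) :=
          hθ.comp (htime s hs.le)
        simpa [harg] using (h1.mul_const (2 * |R|)).div_const (Real.sqrt (-s))
      have hε0 : ∀ j, 0 ≤ η (arg j) := fun j => by
        rw [← hη0]; exact hηm self_mem_Ici (harg0 j) (harg0 j)
      have hεlim : Tendsto (fun j => η (arg j)) atTop (𝓝 0) := by
        rw [← hη0]
        exact (hηc.continuousWithinAt self_mem_Ici).tendsto.comp
          (tendsto_nhdsWithin_iff.2 ⟨harglim, Eventually.of_forall harg0⟩)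
      have hdlim : Tendsto (fun j => c (φ j) ^ 2 * d₀) atTop (𝓝 0) := by
        simpa using ((hcto.comp hφ.tendsto_atTop).pow 2).mul_const d₀
      refine ⟨fun j => η (arg j), fun j => c (φ j) ^ 2 * d₀, hεlim, hdlim, hε0,
        fun j => by positivity, ?_⟩
      filter_upwards [hmem s hs.le, hsmall (4 * (|R| + 1))] with j hj hjR z hz z' hz' hdz hdz'
      -- points of `B(0, R)` lie inside the plateau of the bump and map into `B(x₁, r₀)`
      have hR1 : |R| + 1 < ρ j := hρbig j (|R| + 1) (by positivity) hjR
      have hzn : ‖z‖ < |R| + 1 := by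
        rw [mem_ball_zero_iff] at hz; linarith [le_abs_self R]
      have hzn' : ‖z'‖ < |R| + 1 := by
        rw [mem_ball_zero_iff] at hz'; linarith [le_abs_self R]
      have hzρ : ‖z‖ < ρ j := hzn.trans hR1
      have hzρ' : ‖z'‖ < ρ j := hzn'.trans hR1
      have hphys : ∀ z₀ : EuclideanSpace ℝ (Fin 3), ‖z₀‖ < |R| + 1 →
          x (φ j) + c (φ j) • z₀ ∈ ball x₁ r₀ := by
        intro z₀ hz₀
        refine hball j z₀ ?_
        have hc' := hc0 (φ j)
        nlinarith
      rw [hcurl' j z hzρ] at hdz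
      rw [hcurl' j z' hzρ'] at hdz'
      rw [hdir' j z hzρ, hdir' j z' hzρ']
      set k := φ j with hk
      set t' : ℝ := t k + c k ^ 2 * s with ht'
      have ht'I : t' ∈ Ioo 0 Y.T := ⟨hj.1, hj.2.trans_lt (ht k).2⟩
      -- physical vorticities above `d₀`
      have hcurl : ∀ z₀ : EuclideanSpace ℝ (Fin 3),
          ‖curl (w j s) z₀‖ = c k * c k * ‖curl (Y.u t') (x k + c k • z₀)‖ := fun z₀ => by
        rw [hw, curl_smul_stPull, norm_smul, Real.norm_of_nonneg (mul_self_nonneg _)]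
      have hcc : 0 < c k * c k := mul_pos (hc0 k) (hc0 k)
      have hd1 : d₀ < ‖curl (Y.u t') (x k + c k • z)‖ := by
        rw [hcurl, sq] at hdz; exact lt_of_mul_lt_mul_left (by linarith) hcc.le
      have hd2 : d₀ < ‖curl (Y.u t') (x k + c k • z')‖ := by
        rw [hcurl, sq] at hdz'; exact lt_of_mul_lt_mul_left (by linarith) hcc.le
      rw [hw, vorticityDirection_zoom (hc0 k), vorticityDirection_zoom (hc0 k)]
      refine (hal t' ht'I _ (hphys z hzn) _ (hphys z' hzn') hd1 hd2).trans (hηm ?_ (harg0 j) ?_)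
      · exact mem_Ici.2 (div_nonneg (mul_nonneg (hθ0 _) (norm_nonneg _)) (Real.sqrt_nonneg _))
      · -- `θ(t') · c‖z − z'‖/√(T − t') ≤ θ(t') · 2|R|/√(−s)`
        have hyy : ‖(x k + c k • z) - (x k + c k • z')‖ = c k * ‖z - z'‖ := by
          rw [add_sub_add_left_eq_sub, ← smul_sub, norm_smul, Real.norm_of_nonneg (hc0 k).le]
        have hdist : ‖z - z'‖ ≤ 2 * |R| := by
          rw [mem_ball_zero_iff] at hz hz'
          calc ‖z - z'‖ ≤ ‖z‖ + ‖z'‖ := norm_sub_le _ _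
            _ ≤ 2 * |R| := by linarith [le_abs_self R]
        have h2 := hsqrt s hs.le j
        have hTt : 0 < Real.sqrt (1 * (Y.T - t')) := by
          rw [one_mul]; exact lt_of_lt_of_le (mul_pos (hc0 k) hs0) h2
        rw [hyy, harg]
        show θ t' * (c k * ‖z - z'‖) / Real.sqrt (1 * (Y.T - t')) ≤
          θ (t (φ j) + c (φ j) ^ 2 * s) * (2 * |R|) / Real.sqrt (-s)
        rw [← ht', div_le_div_iff₀ hTt hs0, one_mul]
        have hθt : 0 ≤ θ t' := hθ0 t'
        have hck : 0 ≤ c k * Real.sqrt (-s) := (mul_pos (hc0 k) hs0).le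
        calc θ t' * (c k * ‖z - z'‖) * Real.sqrt (-s)
            = θ t' * ‖z - z'‖ * (c k * Real.sqrt (-s)) := by ring
          _ ≤ θ t' * (2 * |R|) * Real.sqrt (Y.T - t') := by
              gcongr
  -- ### (4) Giga–Miura's Propositions 2.2 and 2.1 on the limit collide
  let ζ₀ : ℝ → EuclideanSpace ℝ (Fin 3) := fun s =>
    if h : s < 0 then Classical.choose (hdir s h) else 0
  have hζ₀ : ∀ s < 0, ∀ z, curl (W s) z = ‖curl (W s) z‖ • ζ₀ s := by
    intro s hs z
    simp only [ζ₀, dif_pos hs]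
    exact Classical.choose_spec (hdir s hs) z
  have hzero : ∀ s < 0, ∀ z, curl (W s) z = 0 :=
    gigaMiura2011_unidirectional_vorticity_eq_zero_holds hsm hder hWdiv0 hWmild0 ⟨ζ₀, hζ₀⟩
  exact gigaMiura2011_curl_not_identically_zero_of_typeI (C₀ := C)
    (fun s hs => (hslice s hs).of_le (by norm_cast)) ⟨4, hW4⟩ hWdiv0 hWmild0 hnt hIW hzero

end ClayBlowup

end Summit.NavierStokesRegularity.FluidComputer

end
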